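import Literature.MathematicalPhysics.QuantumLattice.BlockProductStates
import Literature.MathematicalPhysics.QuantumLattice.XYZGroundStateOrderPlaquette
import Literature.MathematicalPhysics.QuantumLattice.XYZGroundStateOrderProofs
import Literature.MathematicalPhysics.QuantumLattice.TorusCooperSum
import HarnessLib

/-!
# A plaquette variational bound for the anisotropic spin-½ model on the even square torus, II: the energy

Topic `MathematicalPhysics/QuantumLattice`; part 2 of `XYZGroundStateOrderPlaquette.lean` (see its
module docstring for the context: Björnberg–Ueltschi / Kubo–Kishi / Wischmann–Müller-Hartmann).
Here the plaquette product state `Ψ = blockProductState (plaquetteEquiv k) plaquetteState = ⨂_{plaquettes} φ`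
on `(ℤ/2kℤ)²` (`BlockProductStates.lean`, `plaquetteEquiv`; `card_torusSite_two` of `TorusCooperSum.lean`) is fed into the variational principle for
`H₀ = anisotropicTorus 2 (2k) 1 J₁ J₂ 1 = -Σ_x Σ_{y∼x}(J₁SˣSˣ + J₂SʸSʸ + SᶻSᶻ)`:

* `plaquetteProductState_pairSum`: for each site `x`, direction `i` and component `α`, one of the
  bonds `(x, x ± eᵢ)` is inside the plaquette of `x` (value `plaquettePairVal α · n^{k²-1}`) and the
  other crosses to a distinct plaquette (value `plaquetteMagVal α² · n^{k²-2}`), `n = ⟨φ,φ⟩`;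
* `plaquetteProductState_energy`: `⟨Ψ, H₀Ψ⟩ = -2(2k)²[(J₁·107/2000 - J₂·99/2000 + 10001/40000)n^{k²-1}
  + (9991/20000)² n^{k²-2}]`;
* `groundEnergy_mul_normSq_le`: `E₀⟨ψ,ψ⟩ ≤ Re⟨ψ,Aψ⟩` (Rayleigh with an unnormalised vector);
* `xyz_plaquette_bound`: `c⁰ + J₂c¹ + J₁c² ≥ ½(535J₁/10417 - 495J₂/10417 + 10001/41668 + (9991/20834)²)`
  on every even torus of side `2k ≥ 4` — the input replacing B–U's polarised-state bound `¼` in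
  `XYZGroundStateOrderWindow.lean`.

Standard material; no statement of the tree is changed.
-/

noncomputable section

open Matrix Complex Finset
open scoped ComplexOrder
open Literature.MathematicalPhysics.QuantumLattice.SpinOperators Literature.Probability.LatticeModels

namespace Literature.MathematicalPhysics.QuantumLattice

/-! ### The energy of the plaquette product state -/

section Energy

variable {k : ℕ} [NeZero k]

/-- **The nearest-neighbour pair sum of the plaquette product state.** For every site `x`,
direction `i` and component `α`, exactly one of the two bonds `(x, x ± eᵢ)` lies inside the
plaquette of `x` (two-point value `plaquettePairVal α` times `⟨φ,φ⟩^{k²-1}`) and the other one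
crosses to a neighbouring plaquette (product of one-point values times `⟨φ,φ⟩^{k²-2}`), `k ≥ 2`.
[folklore] -/
theorem plaquetteProductState_pairSum (hk : 2 ≤ k) (x : TorusSite 2 (2 * k)) (i : Fin 2) (α : Fin 3) :
    star (blockProductState (plaquetteEquiv k) plaquetteState) ⬝ᵥ (onSite x (spinVec 1 α) *ᵥ
        (onSite (x + Pi.single i 1) (spinVec 1 α) *ᵥ blockProductState (plaquetteEquiv k) plaquetteState)) +
      star (blockProductState (plaquetteEquiv k) plaquetteState) ⬝ᵥ (onSite x (spinVec 1 α) *ᵥ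
        (onSite (x - Pi.single i 1) (spinVec 1 α) *ᵥ blockProductState (plaquetteEquiv k) plaquetteState)) =
      plaquettePairVal α * (10417 / 10000 : ℂ) ^ (Fintype.card (TorusSite 2 k) - 1) +
        plaquetteMagVal α * plaquetteMagVal α * (10417 / 10000 : ℂ) ^ (Fintype.card (TorusSite 2 k) - 2) := by
  set e := plaquetteEquiv k with he
  set b₀ := (e x).1 with hb₀
  obtain ⟨a, b, hf⟩ : ∃ a b : Fin 2, (e x).2 = ![a, b] := ⟨_, _, fin_two_fun_eq _⟩
  have hx : e x = (b₀, ![a, b]) := by rw [← hf]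
  have hadd := plaquetteEquiv_add_single x i
  have hsub := plaquetteEquiv_sub_single x i
  rw [← he, hf] at hadd hsub
  obtain ⟨hneA, hneS⟩ := ne_add_single_of_two_le hk b₀ i
  have h2 : ∀ c : Fin 2, c = 0 ∨ c = 1 := by decide
  rcases h2 (![a, b] i) with h0 | h1
  · rw [if_pos h0] at hadd hsub
    have hp : Function.update ![a, b] i (![a, b] i + 1) = Function.update ![a, b] i 1 := by
      rw [h0, zero_add]
    rw [blockProductState_expect_onSite_onSite_same e plaquetteState hx hadd,
      blockProductState_expect_onSite_onSite_ne e plaquetteState hx hsub hneS,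
      ← hp, plaquetteState_twoPoint, plaquetteState_onePoint, plaquetteState_onePoint_update,
      plaquetteState_norm]
  · rw [if_neg (by rw [h1]; decide)] at hadd hsub
    have hp : Function.update ![a, b] i (![a, b] i + 1) = Function.update ![a, b] i 0 := by
      rw [h1, show (1 : Fin 2) + 1 = 0 from by decide]
    rw [blockProductState_expect_onSite_onSite_ne e plaquetteState hx hadd hneA,
      blockProductState_expect_onSite_onSite_same e plaquetteState hx hsub,
      ← hp, plaquetteState_twoPoint, plaquetteState_onePoint, plaquetteState_onePoint_update,
      plaquetteState_norm]
    ring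

/-- **The energy of the plaquette product state**:
`⟨Ψ, H₀ Ψ⟩ = -2|Λ| [(J₁·107/2000 - J₂·99/2000 + 10001/40000) n^{k²-1} + (9991/20000)² n^{k²-2}]`,
`n = ⟨φ,φ⟩ = 10417/10000`, `|Λ| = (2k)²`, for `H₀ = anisotropicTorus 2 (2k) 1 J₁ J₂ 1` and `k ≥ 2`.
[folklore] -/
theorem plaquetteProductState_energy (hk : 2 ≤ k) (J₁ J₂ : ℝ) :
    haveI : NeZero (2 * k) := ⟨by omega⟩
    star (blockProductState (plaquetteEquiv k) plaquetteState) ⬝ᵥ (anisotropicTorus 2 (2 * k) 1 J₁ J₂ 1 *ᵥ blockProductState (plaquetteEquiv k) plaquetteState) =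
      -((((2 * k : ℕ) : ℂ) ^ 2 * 2) *
        (((J₁ : ℂ) * (107 / 2000) + (J₂ : ℂ) * (-99 / 2000) + 10001 / 40000) *
            (10417 / 10000 : ℂ) ^ (Fintype.card (TorusSite 2 k) - 1) +
          (9991 / 20000 : ℂ) * (9991 / 20000) * (10417 / 10000 : ℂ) ^ (Fintype.card (TorusSite 2 k) - 2))) := by
  haveI : NeZero (2 * k) := ⟨by omega⟩
  have hL : 3 ≤ 2 * k := by omega
  set Ψ := blockProductState (plaquetteEquiv k) plaquetteState with hΨ
  set N : ℂ := 10417 / 10000 with hN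
  set K := Fintype.card (TorusSite 2 k) with hK
  -- the pair expectation
  set P : TorusSite 2 (2 * k) → TorusSite 2 (2 * k) → Fin 3 → ℂ :=
    fun x y α => star Ψ ⬝ᵥ (onSite x (spinVec 1 α) *ᵥ (onSite y (spinVec 1 α) *ᵥ Ψ)) with hP
  have hpair : ∀ (x : TorusSite 2 (2 * k)) (i : Fin 2) (α : Fin 3),
      P x (x + Pi.single i 1) α + P x (x - Pi.single i 1) α =
        plaquettePairVal α * N ^ (K - 1) + plaquetteMagVal α * plaquetteMagVal α * N ^ (K - 2) := by
    intro x i α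
    simp only [hP, hΨ, hN, hK]
    exact plaquetteProductState_pairSum hk x i α
  -- the expectation of one summand of `H₀`
  have hterm : ∀ x y : TorusSite 2 (2 * k),
      star Ψ ⬝ᵥ (((J₁ : ℂ) • (siteSpin 1 x 0 * siteSpin 1 y 0) + (J₂ : ℂ) • (siteSpin 1 x 1 * siteSpin 1 y 1) +
          ((1 : ℝ) : ℂ) • (siteSpin 1 x 2 * siteSpin 1 y 2)) *ᵥ Ψ) =
        (J₁ : ℂ) * P x y 0 + (J₂ : ℂ) * P x y 1 + P x y 2 := by
    intro x y
    simp only [hP, siteSpin, add_mulVec, smul_mulVec, ← mulVec_mulVec, dotProduct_add,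
      dotProduct_smul, smul_eq_mul, Complex.ofReal_one, one_mul]
  rw [anisotropicTorus_eq, neg_mulVec, dotProduct_neg, sum_mulVec, dotProduct_sum]
  simp_rw [sum_mulVec, dotProduct_sum]
  have hite : ∀ x y : TorusSite 2 (2 * k),
      star Ψ ⬝ᵥ ((if (torusGraph 2 (2 * k)).Adj x y then
          (J₁ : ℂ) • (siteSpin 1 x 0 * siteSpin 1 y 0) + (J₂ : ℂ) • (siteSpin 1 x 1 * siteSpin 1 y 1) +
            ((1 : ℝ) : ℂ) • (siteSpin 1 x 2 * siteSpin 1 y 2)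
        else 0) *ᵥ Ψ) =
        if (torusGraph 2 (2 * k)).Adj x y then (J₁ : ℂ) * P x y 0 + (J₂ : ℂ) * P x y 1 + P x y 2 else 0 := by
    intro x y
    split_ifs
    · exact hterm x y
    · simp
  simp_rw [hite]
  have hrow : ∀ x : TorusSite 2 (2 * k),
      (∑ y, if (torusGraph 2 (2 * k)).Adj x y then (J₁ : ℂ) * P x y 0 + (J₂ : ℂ) * P x y 1 + P x y 2 else 0) =
        2 * ((J₁ : ℂ) * (plaquettePairVal 0 * N ^ (K - 1) + plaquetteMagVal 0 * plaquetteMagVal 0 * N ^ (K - 2)) +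
          (J₂ : ℂ) * (plaquettePairVal 1 * N ^ (K - 1) + plaquetteMagVal 1 * plaquetteMagVal 1 * N ^ (K - 2)) +
          (plaquettePairVal 2 * N ^ (K - 1) + plaquetteMagVal 2 * plaquetteMagVal 2 * N ^ (K - 2))) := by
    intro x
    rw [sum_ite_torusGraph_adj' hL x (fun y => (J₁ : ℂ) * P x y 0 + (J₂ : ℂ) * P x y 1 + P x y 2)]
    have : ∀ i : Fin 2, (J₁ : ℂ) * P x (x + Pi.single i 1) 0 + (J₂ : ℂ) * P x (x + Pi.single i 1) 1 +
          P x (x + Pi.single i 1) 2 +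
        ((J₁ : ℂ) * P x (x - Pi.single i 1) 0 + (J₂ : ℂ) * P x (x - Pi.single i 1) 1 + P x (x - Pi.single i 1) 2) =
        (J₁ : ℂ) * (plaquettePairVal 0 * N ^ (K - 1) + plaquetteMagVal 0 * plaquetteMagVal 0 * N ^ (K - 2)) +
          (J₂ : ℂ) * (plaquettePairVal 1 * N ^ (K - 1) + plaquetteMagVal 1 * plaquetteMagVal 1 * N ^ (K - 2)) +
          (plaquettePairVal 2 * N ^ (K - 1) + plaquetteMagVal 2 * plaquetteMagVal 2 * N ^ (K - 2)) := by
      intro i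
      rw [← hpair x i 0, ← hpair x i 1, ← hpair x i 2]
      ring
    simp_rw [this]
    rw [sum_const, card_univ, Fintype.card_fin, nsmul_eq_mul]
    push_cast
    ring
  simp_rw [hrow]
  rw [sum_const, card_univ, nsmul_eq_mul]
  rw [show Fintype.card (TorusSite 2 (2 * k)) = (2 * k) ^ 2 from card_torusSite_two (2 * k)]
  simp only [plaquettePairVal_zero, plaquettePairVal_one, plaquettePairVal_two, plaquetteMagVal_zero,
    plaquetteMagVal_one, plaquetteMagVal_two]
  push_cast
  ring

/-- The norm of the plaquette product state: `⟨Ψ,Ψ⟩ = (10417/10000)^{k²}`. [folklore] -/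
theorem plaquetteProductState_norm (k : ℕ) [NeZero k] :
    star (blockProductState (plaquetteEquiv k) plaquetteState) ⬝ᵥ blockProductState (plaquetteEquiv k) plaquetteState =
      (10417 / 10000 : ℂ) ^ Fintype.card (TorusSite 2 k) := by
  rw [star_blockProductState_dotProduct_self, plaquetteState_norm]

/-- **The variational principle with an unnormalised trial vector**:
`E₀(A) ⟨ψ,ψ⟩ ≤ Re ⟨ψ, Aψ⟩` for Hermitian `A` (`⟨ψ,(A - E₀)ψ⟩ ≥ 0`). Tasaki (2020) §2.1, (2.1.6);
Reed–Simon IV, Thm. XIII.1. [folklore] -/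
theorem groundEnergy_mul_normSq_le {m : Type*} [Fintype m] [DecidableEq m] {A : Matrix m m ℂ}
    (hA : A.IsHermitian) (ψ : m → ℂ) :
    A.groundEnergy * (star ψ ⬝ᵥ ψ).re ≤ (star ψ ⬝ᵥ (A *ᵥ ψ)).re := by
  have h := (Matrix.posSemidef_sub_groundEnergy hA).dotProduct_mulVec_nonneg ψ
  rw [sub_mulVec, dotProduct_sub, Algebra.algebraMap_eq_smul_one, smul_mulVec, one_mulVec,
    dotProduct_smul] at h
  obtain ⟨hre, -⟩ := Complex.nonneg_iff.mp h
  simp only [Complex.sub_re, Complex.real_smul, Complex.mul_re, Complex.ofReal_re, Complex.ofReal_im,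
    zero_mul, sub_zero] at hre
  linarith

/-- **The plaquette variational bound** (cluster mean-field improvement of B–U (3.10) /
Kubo–Kishi's variational step): on the torus of side `L = 2k ≥ 4`, for the rotated anisotropic
Hamiltonian `H' = anisotropicTorus 2 L 1 1 J₂ J₁` (unitarily equivalent to
`H₀ = anisotropicTorus 2 L 1 J₁ J₂ 1`, `E₀(H') = E₀(H₀) = -4L²(c⁰ + J₂c¹ + J₁c²)`),
`c⁰ + J₂c¹ + J₁c² ≥ ½ (535 J₁/10417 - 495 J₂/10417 + 10001/41668 + (9991/20834)²)`, from
`E₀(H₀) ≤ ⟨Ψ, H₀Ψ⟩/⟨Ψ,Ψ⟩` for the plaquette product state `Ψ`. For `J₁ = 1`, `J₂ = -ρ` the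
right-hand side is `0.26067… + 0.02375… ρ` (the polarised state gives `¼`). [folklore] -/
theorem xyz_plaquette_bound (hk : 2 ≤ k) (J₁ J₂ : ℝ) :
    haveI : NeZero (2 * k) := ⟨by omega⟩
    (1 / 2 : ℝ) * (J₁ * (535 / 10417) + J₂ * (-(495 / 10417)) + 10001 / 41668 + (9991 / 20834) ^ 2) ≤
      xyzBondCorr (d := 2) 0 (2 * k) 1 J₁ J₂ + J₂ * xyzBondCorr (d := 2) 1 (2 * k) 1 J₁ J₂ +
        J₁ * xyzBondCorr (d := 2) 2 (2 * k) 1 J₁ J₂ := by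
  haveI : NeZero (2 * k) := ⟨by omega⟩
  have hL : 3 ≤ 2 * k := by omega
  set H₀ := anisotropicTorus 2 (2 * k) 1 J₁ J₂ 1 with hH₀
  have hHerm₀ : H₀.IsHermitian := anisotropicTorus_isHermitian (2 * k) 1 J₁ J₂ 1
  -- (1) `E₀(H') = E₀(H₀)` (global spin rotation, as in `xyz_polarised_bound`)
  obtain ⟨V, hV, hV', hVz, hVx, hVy⟩ := exists_unitary_conj_spinZ_eq_spinX 1
  set W : Op (TorusSite 2 (2 * k)) (1 + 1) := productOp (fun _ : TorusSite 2 (2 * k) => V) with hW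
  have hconj : W * H₀ * Wᴴ = anisotropicTorus 2 (2 * k) 1 1 J₂ J₁ := by
    rw [hW, hH₀, globalOp_conj_anisotropicTorus hV hV' (γ := ![2, 1, 0]) (ε := ![-1, 1, 1])
      (fun α => by fin_cases α <;> simp) (fun α => by
        fin_cases α
        · simpa using hVx
        · simpa using hVy
        · simpa using hVz) J₁ J₂ 1, anisotropicTorus_eq]
    rw [neg_inj]
    refine sum_congr rfl fun x _ => sum_congr rfl fun y _ => ?_
    split_ifs
    · simp only [Matrix.cons_val_zero, Matrix.cons_val_one, Matrix.cons_val]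
      abel
    · rfl
  have hWu : W ∈ Matrix.unitaryGroup (TensorIndex (TorusSite 2 (2 * k)) (1 + 1)) ℂ :=
    Matrix.mem_unitaryGroup_iff.2 (productOp_mul_conjTranspose fun _ => hV)
  have hE : (anisotropicTorus 2 (2 * k) 1 1 J₂ J₁).groundEnergy = H₀.groundEnergy := by
    rw [← hconj, Matrix.groundEnergy_unitary_conj hWu]
  -- (2) the variational principle with `Ψ`
  set K := Fintype.card (TorusSite 2 k) with hK
  have hK2 : 2 ≤ K := by
    rw [hK, card_torusSite_two]; nlinarith
  set N : ℝ := 10417 / 10000 with hN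
  have hNpos : 0 < N := by norm_num [hN]
  have hNc : (10417 / 10000 : ℂ) = ((N : ℝ) : ℂ) := by rw [hN]; push_cast; ring
  have hnorm : (star (blockProductState (plaquetteEquiv k) plaquetteState) ⬝ᵥ blockProductState (plaquetteEquiv k) plaquetteState).re = N ^ K := by
    rw [plaquetteProductState_norm, ← hK, hNc, ← Complex.ofReal_pow, Complex.ofReal_re]
  have henergy : (star (blockProductState (plaquetteEquiv k) plaquetteState) ⬝ᵥ (H₀ *ᵥ blockProductState (plaquetteEquiv k) plaquetteState)).re =
      -((((2 * k : ℕ) : ℝ) ^ 2 * 2) * ((J₁ * (107 / 2000) + J₂ * (-99 / 2000) + 10001 / 40000) * N ^ (K - 1) +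
          (9991 / 20000) * (9991 / 20000) * N ^ (K - 2))) := by
    have h := plaquetteProductState_energy hk J₁ J₂
    rw [← hK] at h
    rw [hH₀, h, hNc]
    have hc : -((((2 * k : ℕ) : ℂ) ^ 2 * 2) *
        (((J₁ : ℂ) * (107 / 2000) + (J₂ : ℂ) * (-99 / 2000) + 10001 / 40000) * ((N : ℝ) : ℂ) ^ (K - 1) +
          (9991 / 20000 : ℂ) * (9991 / 20000) * ((N : ℝ) : ℂ) ^ (K - 2))) =
        ((-((((2 * k : ℕ) : ℝ) ^ 2 * 2) * ((J₁ * (107 / 2000) + J₂ * (-99 / 2000) + 10001 / 40000) * N ^ (K - 1) +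
          (9991 / 20000) * (9991 / 20000) * N ^ (K - 2))) : ℝ) : ℂ) := by
      push_cast; ring
    rw [hc, Complex.ofReal_re]
  have hvar := groundEnergy_mul_normSq_le hHerm₀ (blockProductState (plaquetteEquiv k) plaquetteState)
  rw [hnorm, henergy, ← hE, groundEnergy_anisotropicTorus_eq (2 * k) 1 J₁ J₂ hL (by norm_num)] at hvar
  -- (3) divide by `N^K = N·N^{K-1} = N²·N^{K-2}`
  have hK1 : N ^ K = N * N ^ (K - 1) := by
    rw [← pow_succ']; congr 1; omega
  have hK2' : N ^ (K - 1) = N * N ^ (K - 2) := by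
    rw [← pow_succ']; congr 1; omega
  have hpow : 0 < N ^ (K - 2) := pow_pos hNpos _
  have hLpos : (0 : ℝ) < (((2 * k : ℕ) : ℝ)) ^ 2 := by
    have hk' : (2 : ℝ) ≤ k := by exact_mod_cast hk
    have : (0 : ℝ) < ((2 * k : ℕ) : ℝ) := by push_cast; linarith
    positivity
  rw [hK1, hK2'] at hvar
  simp only [Nat.cast_ofNat] at hvar
  set ε := xyzBondCorr (d := 2) 0 (2 * k) 1 J₁ J₂ + J₂ * xyzBondCorr (d := 2) 1 (2 * k) 1 J₁ J₂ +
    J₁ * xyzBondCorr (d := 2) 2 (2 * k) 1 J₁ J₂ with hε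
  have key : (((2 * k : ℕ) : ℝ)) ^ 2 * N ^ (K - 2) *
      (2 * ((J₁ * (107 / 2000) + J₂ * (-99 / 2000) + 10001 / 40000) * N + (9991 / 20000) * (9991 / 20000)) -
        4 * N * N * ε) ≤ 0 := by
    nlinarith
  have key' : 2 * ((J₁ * (107 / 2000) + J₂ * (-99 / 2000) + 10001 / 40000) * N + (9991 / 20000) * (9991 / 20000)) -
      4 * N * N * ε ≤ 0 := by
    rcases le_or_gt (2 * ((J₁ * (107 / 2000) + J₂ * (-99 / 2000) + 10001 / 40000) * N +
      (9991 / 20000) * (9991 / 20000)) - 4 * N * N * ε) 0 with h | h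
    · exact h
    · exfalso
      have := mul_pos (mul_pos hLpos hpow) h
      linarith
  rw [hN] at key'
  nlinarith [key']

end Energy

end Literature.MathematicalPhysics.QuantumLattice

end
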